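import Literature.AlgebraicTopology.SingularHomology.LocalCapProduct
import Literature.AlgebraicTopology.SingularHomology.RelativeCochainsMaps
import Literature.AlgebraicTopology.SingularHomology.CechCapProduct
import HarnessLib

/-!
# The cap product `Hᵖ(X | K) ⊗ Hₙ(X | K) → H_q(U)` of Poincaré duality for noncompact manifolds

A. Hatcher, *Algebraic Topology* (2002), §3.3, pp. 239–240 and p. 245: the relative cap product
`H_k(X, A; R) × H^l(X, A; R) → H_{k-l}(X; R)` ("using … the relative cochain group `C^l(X, A; R)`
… the cap product `C_k(X; R) × C^l(X; R) → C_{k-l}(X; R)` … induces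
`C_k(X, A; R) × C^l(X, A; R) → C_{k-l}(X; R)`"), and, for `K ⊆ L` compact in a manifold `M`, the
diagram on p. 245 defining the duality map `D_M : H^k_c(M; R) → H_{n-k}(M; R)`,
`φ ↦ μ_K ⌢ φ` for `φ ∈ H^k(M | K; R) = H^k(M, M - K; R)`, with its compatibility
`μ_K ⌢ x = μ_L ⌢ i^*(x)` ("by the naturality of cap product"), and proof of Lemma 3.36 (p. 246):
for `K ⊆ U` open, `μ_K ⌢ φ` is computed in `H_{n-k}(U)` by capping a representative of `μ_K`
made of chains in `U` ("via barycentric subdivision").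

For the tree's concrete singular chains (`csingularChainComplex`, `SingularChainsConcrete.lean`),
its local homology `Hₙ(X | K) = Hₙ(C(X)/C(X ∖ K))` (`clocalHomology`, `LocalHomology.lean`), its
relative function cochains `Cᵖ(X, X ∖ K)` (`relCochains`, `relSingularCohomology`,
`RelativeCochains.lean`) and the Alexander–Whitney cap `ccapChain` with its boundary formula
(`RelativeCapProduct.lean`, `LocalCapProduct.lean`), this file constructs, for `K ⊆ W` with `K`
closed and `W` open:

* `capcSmall` — the class in `H_q(C(W))` of `x ⌢ φ` for a `W`-small relative cycle `x` of
  `(X, X ∖ K)` and a cochain `φ` vanishing on the simplices of `X ∖ K` that is a cocycle on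
  `W`-small simplices: `x ⌢ φ` is a chain of `W` and a CYCLE, since `∂x ⌢ φ = 0` (`∂x` lies in
  `X ∖ K` where `φ` vanishes) — independent of the representative (`capcSmall_eq_of_relCls_eq`),
  zero on relative coboundaries (`capcSmall_eq_zero_of_coboundary`), additive;
* `capc hK hW hKW h hφ hφK α ∈ H_q(C(W))` — **`α ⌢ φ` for `α ∈ Hₙ(X | K)`** (a `W`-small
  representative exists by excision / small chains, `clocalHomology.exists_small_relCls_eq`);
* `capcH … α : Hᵖ(X, X ∖ K; R) →ₗ[R] H_q(C(W); M)` — **the map `φ ↦ α ⌢ φ` on relative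
  cohomology** `Hᵖ(X, X ∖ K; R) = Hᵖ(relCochainComplex R R Kᶜ)` (= `relSingularCohomology R R X Kᶜ p`
  by definition; Hatcher p. 245, the rows of the diagram defining `D_M`), with its value on classes
  (`capcH_homologyCls`);
* naturality: in the compact set, `(α|_K) ⌢ φ = α ⌢ (ext φ)` for `K ⊆ L`, `α ∈ Hₙ(X | L)`,
  `φ ∈ Hᵖ(X | K)` (`capc_res`, `capcH_res` — Hatcher p. 245, "`μ_K ⌢ x = μ_L ⌢ i^*(x)`"); in the
  open set, `incl_* (α ⌢ φ)_W = (α ⌢ φ)_{W'}` for `W ⊆ W'` (`homologyMap_incl_capc`).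

Everything is proved; no named facts. This is the first file of the tree's formalisation of
Poincaré duality for noncompact manifolds (Hatcher Thm. 3.35).

## References

* A. Hatcher, *Algebraic Topology*, CUP 2002, §3.3 pp. 239–240 (relative cap products, boundary
  formula), p. 245 (the duality map `D_M`), Lemma 3.36 (p. 246). [HatcherAT2002]
-/

noncomputable section

-- as in `SingularChainsConcrete` / `LocalCapProduct`: chains of the concrete complex are `Finsupp`s
-- up to unfolding of semireducible definitions
set_option backward.isDefEq.respectTransparency false

open CategoryTheory Limits

universe u v

namespace Literature.AlgebraicTopology.SingularHomology

variable {R : Type v} [CommRing R] {M : Type v} [AddCommGroup M] [Module R M]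
variable {X : Type u} [TopologicalSpace X]

/-! ### Chain level: capping with a cochain that vanishes away from `K` -/

section ChainLevel

variable {p q n : ℕ}

/-- The cover of (a neighbourhood of) `K` by a single set `W`, indexed by `Unit`. [folklore] -/
abbrev coverOne (W : Set X) : Unit → Set X := fun _ => W

omit [TopologicalSpace X] in
/-- `⋃ coverOne W = W`. [folklore] -/
@[simp] lemma iUnion_coverOne (W : Set X) : (⋃ i, coverOne W i) = W := Set.iUnion_const W

variable (R M) in
/-- The `W`-small chains for the one-set cover are the chains of `W`. [folklore] -/
lemma smallChains_coverOne (W : Set X) (n : ℕ) :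
    smallChains R M X (coverOne W) n = chainsIn R M X W n :=
  le_antisymm (iSup_le fun _ => le_rfl) (le_iSup (fun _ : Unit => chainsIn R M X W n) ())

/-- **A cochain vanishing on the simplices of `A` caps the chains of `A` to zero** (the front face
of a simplex in `A` lies in `A`; Hatcher 2002, §3.3 p. 239: the cap product with `C^l(X, A; R)`
factors through `C_k(X; R)/C_k(A; R)`). [cite: HatcherAT2002, §3.3 p. 239] -/
lemma ccapChain_eq_zero_of_mem_relCochains (h : p + q = n) {A : Set X}
    {φ : SingularSimplex X p → R} (hφ : φ ∈ relCochains R R A p) {c : CChain M X n}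
    (hc : c ∈ chainsIn R M X A n) : ccapChain M h φ c = 0 := by
  rw [← Finsupp.sum_single c, Finsupp.sum, map_sum]
  refine Finset.sum_eq_zero fun σ hσ => ?_
  rw [ccapChain_single, hφ _ ((SingularSimplex.range_frontFace_subset _ σ).trans
    ((mem_chainsIn_iff R M c).mp hc σ hσ)), zero_smul, Finsupp.single_zero]

/-- **`x ⌢ φ` is a cycle** for a relative cycle `x` of `(X, X ∖ K)`, small for a cover `U` on whose
small simplices `φ` is a cocycle, and `φ` vanishing on the simplices of `X ∖ K`:
`∂(x ⌢ φ) = ±(∂x ⌢ φ - x ⌢ δφ) = 0` (Hatcher 2002, §3.3 p. 240 and p. 245).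
[cite: HatcherAT2002, §3.3 p. 245] -/
theorem d_ccapChain_eq_zero_of_relCochains (K : Set X) (h : p + q = n) {ι : Type*} {U : ι → Set X}
    {φ : SingularSimplex X p → R} (hφ : IsCocycleOn U φ) (hφK : φ ∈ relCochains R R Kᶜ p)
    {x : (csingularChainComplex R M X).X n} (hxU : x ∈ smallChains R M X U n)
    (hx : (csingularChainComplex R M X).d n ((ComplexShape.down ℕ).next n) x ∈
      awaySub R M X K ((ComplexShape.down ℕ).next n)) :
    (csingularChainComplex R M X).d q ((ComplexShape.down ℕ).next q) (ccapChain M h φ x) = 0 := by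
  cases q with
  | zero => rw [(csingularChainComplex R M X).shape 0 _ (by simp)]; rfl
  | succ q' =>
    obtain rfl : n = (p + q') + 1 := by omega
    rw [ChainComplex.next_nat_succ] at hx ⊢
    rw [d_ccapChain_of_isCocycleOn (rfl : p + q' = p + q') hφ hxU,
      ccapChain_eq_zero_of_mem_relCochains _ hφK hx, smul_zero]

/-- `x ⌢ φ` is a chain of `W` for `x` `W`-small. [folklore] -/
lemma ccapChain_mem_chainsInSub_of_small (W : Set X) (h : p + q = n) (φ : SingularSimplex X p → R)
    {x : (csingularChainComplex R M X).X n} (hxW : x ∈ smallChains R M X (coverOne W) n) :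
    ccapChain M h φ x ∈ chainsInSub R M X W q := by
  rw [chainsInSub_apply, ← smallChains_coverOne R M W q]
  exact ccapChain_mem_smallChains h (coverOne W) φ hxW

end ChainLevel

/-! ### `capcSmall`: the class of `x ⌢ φ` in `H_q(C(W))` for a small representative `x` -/

section CapcSmall

variable {p q n : ℕ}

variable (M) in
/-- **The class `[x ⌢ φ] ∈ H_q(C(W); M)`** of the cap product of a `W`-small relative `n`-cycle `x`
of `(X, X ∖ K)` with a cochain `φ ∈ Cᵖ(X, X ∖ K; R)` that is a cocycle on the `W`-small simplices
(Hatcher 2002, §3.3 p. 245, `μ_K ⌢ φ ∈ H_{n-k}(M)`; proof of Lemma 3.36, p. 246, computed in `U`).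
[cite: HatcherAT2002, §3.3 p. 245] -/
def capcSmall (W K : Set X) (h : p + q = n) {φ : SingularSimplex X p → R}
    (hφ : IsCocycleOn (coverOne W) φ) (hφK : φ ∈ relCochains R R Kᶜ p)
    (x : (csingularChainComplex R M X).X n) (hxW : x ∈ smallChains R M X (coverOne W) n)
    (hx : (csingularChainComplex R M X).d n ((ComplexShape.down ℕ).next n) x ∈
      awaySub R M X K ((ComplexShape.down ℕ).next n)) :
    (chainsInSub R M X W).toComplex.homology q :=
  homologyCls (K := (chainsInSub R M X W).toComplex)
    ⟨ccapChain M h φ x, ccapChain_mem_chainsInSub_of_small W h φ hxW⟩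
    (Subtype.ext (by
      rw [Subcomplex.toComplex_d_apply_val]
      exact d_ccapChain_eq_zero_of_relCochains K h hφ hφK hxW hx))


namespace capcSmall

variable {W K : Set X} (hK : IsClosed K) (hW : IsOpen W) (hKW : K ⊆ W)

omit [TopologicalSpace X] in
/-- `K ⊆ ⋃ coverOne W` from `K ⊆ W`. [folklore] -/
lemma subset_iUnion_coverOne (hKW : K ⊆ W) : K ⊆ ⋃ i, coverOne W i := by
  rwa [iUnion_coverOne]

/-- The chain `x ⌢ φ ∈ C_q(W)` is a cycle of the complex `C(W)`. [cite: HatcherAT2002, §3.3 p. 245] -/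
lemma d_cycle_eq_zero (h : p + q = n) {φ : SingularSimplex X p → R}
    (hφ : IsCocycleOn (coverOne W) φ) (hφK : φ ∈ relCochains R R Kᶜ p)
    {x : (csingularChainComplex R M X).X n} (hxW : x ∈ smallChains R M X (coverOne W) n)
    (hx : (csingularChainComplex R M X).d n ((ComplexShape.down ℕ).next n) x ∈
      awaySub R M X K ((ComplexShape.down ℕ).next n)) :
    (chainsInSub R M X W).toComplex.d q ((ComplexShape.down ℕ).next q)
      (⟨ccapChain M h φ x, ccapChain_mem_chainsInSub_of_small W h φ hxW⟩ :
        (chainsInSub R M X W).toComplex.X q) = 0 :=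
  Subtype.ext (by
    rw [Subcomplex.toComplex_d_apply_val]
    exact d_ccapChain_eq_zero_of_relCochains K h hφ hφK hxW hx)

include hK hW hKW in
/-- **Independence of the small representative**: two `W`-small relative cycles with the same
class in `Hₙ(X | K)` give the same class `[x ⌢ φ] ∈ H_q(C(W))` — they differ by a `W`-small
boundary modulo `C(X ∖ K)` (`clocalHomology.exists_small_of_relCls_eq_zero`), and
`(∂w) ⌢ φ = ±∂(w ⌢ φ)` while `C(X ∖ K) ⌢ φ = 0` (Hatcher 2002, §3.3 pp. 239–240, the relative cap
product is well defined; p. 245). [cite: HatcherAT2002, §3.3 p. 245] -/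
theorem eq_of_relCls_eq (h : p + q = n) {φ : SingularSimplex X p → R}
    (hφ : IsCocycleOn (coverOne W) φ) (hφK : φ ∈ relCochains R R Kᶜ p)
    {x x' : (csingularChainComplex R M X).X n}
    (hxW : x ∈ smallChains R M X (coverOne W) n)
    (hx : (csingularChainComplex R M X).d n ((ComplexShape.down ℕ).next n) x ∈
      awaySub R M X K ((ComplexShape.down ℕ).next n))
    (hx'W : x' ∈ smallChains R M X (coverOne W) n)
    (hx' : (csingularChainComplex R M X).d n ((ComplexShape.down ℕ).next n) x' ∈
      awaySub R M X K ((ComplexShape.down ℕ).next n))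
    (e : (awaySub R M X K).relCls x hx = (awaySub R M X K).relCls x' hx') :
    capcSmall M W K h hφ hφK x hxW hx = capcSmall M W K h hφ hφK x' hx'W hx' := by
  have hsub : (csingularChainComplex R M X).d n ((ComplexShape.down ℕ).next n) (x - x') ∈
      awaySub R M X K ((ComplexShape.down ℕ).next n) := by
    rw [map_sub]
    exact Submodule.sub_mem _ hx hx'
  have h0 : (awaySub R M X K).relCls (x - x') hsub = 0 := by
    rw [Subcomplex.relCls_sub _ x x' hx hx' hsub, e, sub_self]
  obtain ⟨w, hwW, hw⟩ := clocalHomology.exists_small_of_relCls_eq_zero R M hK (fun _ => hW)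
    (subset_iUnion_coverOne hKW) (Submodule.sub_mem _ hxW hx'W) hsub h0
  unfold capcSmall
  refine (homologyCls_eq_homologyCls_iff _ _ _ _).mpr ?_
  refine (exists_d_prev_eq_iff (ChainComplex.prev ℕ q) _).mpr
    ⟨⟨(-1 : R) ^ p • ccapChain M (show p + (q + 1) = n + 1 by omega) φ w,
      Submodule.smul_mem _ _ (ccapChain_mem_chainsInSub_of_small W _ φ hwW)⟩, ?_⟩
  apply Subtype.ext
  rw [Subcomplex.toComplex_d_apply_val]
  change (csingularChainComplex R M X).d (q + 1) q ((-1 : R) ^ p • ccapChain M _ φ w) =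
    ccapChain M h φ x - ccapChain M h φ x'
  rw [map_smul, d_ccapChain_of_isCocycleOn h hφ hwW, smul_smul, ← mul_pow, neg_one_mul, neg_neg,
    one_pow, one_smul, ← map_sub,
    ← sub_add_cancel ((csingularChainComplex R M X).d (n + 1) n w) (x - x'), map_add,
    ccapChain_eq_zero_of_mem_relCochains h hφK hw, zero_add]

/-- **Relative coboundaries cap to zero**: if `φ = δθ` on the `W`-small simplices for a cochain
`θ` vanishing on the simplices of `X ∖ K`, then `[x ⌢ φ] = 0` in `H_q(C(W))`:
`x ⌢ δθ = ∂x ⌢ θ ∓ ∂(x ⌢ θ)` and `∂x ⌢ θ = 0` (Hatcher 2002, §3.3 p. 240, the boundary formula;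
p. 245, the cap product is defined on `H^k(M | K)`). [cite: HatcherAT2002, §3.3 p. 245] -/
theorem eq_zero_of_coboundary {p' : ℕ} (h : (p' + 1) + q = n)
    {φ : SingularSimplex X (p' + 1) → R} (hφ : IsCocycleOn (coverOne W) φ)
    (hφK : φ ∈ relCochains R R Kᶜ (p' + 1)) (θ : SingularSimplex X p' → R)
    (hθK : θ ∈ relCochains R R Kᶜ p')
    (e : ∀ σ : SingularSimplex X (p' + 1), (∃ i, σ.range ⊆ coverOne W i) →
      φ σ = (singularCochainComplex R R X).d p' (p' + 1) θ σ)
    {x : (csingularChainComplex R M X).X n} (hxW : x ∈ smallChains R M X (coverOne W) n)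
    (hx : (csingularChainComplex R M X).d n ((ComplexShape.down ℕ).next n) x ∈
      awaySub R M X K ((ComplexShape.down ℕ).next n)) :
    capcSmall M W K h hφ hφK x hxW hx = 0 := by
  unfold capcSmall
  obtain rfl : n = (p' + q) + 1 := by omega
  have hx' := hx
  rw [ChainComplex.next_nat_succ] at hx'
  have e1 : ccapChain M h φ x = ccapChain M h ((singularCochainComplex R R X).d p' (p' + 1) θ) x :=
    ccapChain_congr_of_small h _ _ e hxW
  have hbd := d_ccapChain_apply (M := M) (rfl : p' + q = p' + q) θ x
  rw [ccapChain_eq_zero_of_mem_relCochains _ hθK hx', zero_sub, smul_neg] at hbd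
  refine (homologyCls_eq_zero_iff _ _).mpr ?_
  refine (exists_d_prev_eq_iff (ChainComplex.prev ℕ q) _).mpr
    ⟨⟨-((-1 : R) ^ p' • ccapChain M (show p' + (q + 1) = (p' + q) + 1 by omega) θ x),
      Submodule.neg_mem _ (Submodule.smul_mem _ _ (ccapChain_mem_chainsInSub_of_small W _ θ hxW))⟩, ?_⟩
  apply Subtype.ext
  rw [Subcomplex.toComplex_d_apply_val]
  change (csingularChainComplex R M X).d (q + 1) q
    (-((-1 : R) ^ p' • ccapChain M _ θ x)) = ccapChain M h φ x
  rw [map_neg, map_smul, hbd, smul_neg, neg_neg, smul_smul, ← mul_pow, neg_one_mul, neg_neg, one_pow,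
    one_smul, e1]

/-- `[x ⌢ (φ + ψ)] = [x ⌢ φ] + [x ⌢ ψ]` (bilinearity of the cap product, Hatcher 2002, §3.3 p. 239).
[cite: HatcherAT2002, §3.3 p. 239] -/
theorem add (h : p + q = n) {φ ψ : SingularSimplex X p → R}
    (hφ : IsCocycleOn (coverOne W) φ) (hφK : φ ∈ relCochains R R Kᶜ p)
    (hψ : IsCocycleOn (coverOne W) ψ) (hψK : ψ ∈ relCochains R R Kᶜ p)
    {x : (csingularChainComplex R M X).X n} (hxW : x ∈ smallChains R M X (coverOne W) n)
    (hx : (csingularChainComplex R M X).d n ((ComplexShape.down ℕ).next n) x ∈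
      awaySub R M X K ((ComplexShape.down ℕ).next n)) :
    capcSmall M W K h (hφ.add hψ) ((relCochains R R Kᶜ p).add_mem hφK hψK) x hxW hx =
      capcSmall M W K h hφ hφK x hxW hx + capcSmall M W K h hψ hψK x hxW hx := by
  unfold capcSmall
  rw [← homologyCls_add _ _ (d_cycle_eq_zero h hφ hφK hxW hx) (d_cycle_eq_zero h hψ hψK hxW hx)
    (by rw [map_add, d_cycle_eq_zero h hφ hφK hxW hx, d_cycle_eq_zero h hψ hψK hxW hx, add_zero])]
  exact homologyCls_congr (Subtype.ext (by
    change ccapChain M h (φ + ψ) x = ccapChain M h φ x + ccapChain M h ψ x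
    rw [ccapChain_add]; rfl)) _ _

/-- `[x ⌢ (r • φ)] = r • [x ⌢ φ]` (bilinearity of the cap product, Hatcher 2002, §3.3 p. 239).
[cite: HatcherAT2002, §3.3 p. 239] -/
theorem smul (h : p + q = n) (r : R) {φ : SingularSimplex X p → R}
    (hφ : IsCocycleOn (coverOne W) φ) (hφK : φ ∈ relCochains R R Kᶜ p)
    {x : (csingularChainComplex R M X).X n} (hxW : x ∈ smallChains R M X (coverOne W) n)
    (hx : (csingularChainComplex R M X).d n ((ComplexShape.down ℕ).next n) x ∈
      awaySub R M X K ((ComplexShape.down ℕ).next n)) :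
    capcSmall M W K h (hφ.smul r) ((relCochains R R Kᶜ p).smul_mem r hφK) x hxW hx =
      r • capcSmall M W K h hφ hφK x hxW hx := by
  unfold capcSmall
  rw [← homologyCls_smul r _ (d_cycle_eq_zero h hφ hφK hxW hx)
    (by rw [map_smul, d_cycle_eq_zero h hφ hφK hxW hx, smul_zero])]
  exact homologyCls_congr (Subtype.ext (by
    change ccapChain M h (r • φ) x = r • ccapChain M h φ x
    rw [ccapChain_smul]; rfl)) _ _

/-- `[x ⌢ φ]` only depends on the values of `φ` (proof-irrelevance in the side conditions and
extensionality in `φ`). [folklore] -/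
theorem congr (h : p + q = n) {φ φ' : SingularSimplex X p → R} (e : φ = φ')
    (hφ : IsCocycleOn (coverOne W) φ) (hφK : φ ∈ relCochains R R Kᶜ p)
    (hφ' : IsCocycleOn (coverOne W) φ') (hφ'K : φ' ∈ relCochains R R Kᶜ p)
    {x : (csingularChainComplex R M X).X n} (hxW : x ∈ smallChains R M X (coverOne W) n)
    (hx : (csingularChainComplex R M X).d n ((ComplexShape.down ℕ).next n) x ∈
      awaySub R M X K ((ComplexShape.down ℕ).next n)) :
    capcSmall M W K h hφ hφK x hxW hx = capcSmall M W K h hφ' hφ'K x hxW hx := by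
  subst e
  rfl

end capcSmall

end CapcSmall

/-! ### `capc`: `α ⌢ φ ∈ H_q(C(W))` for a local homology class `α ∈ Hₙ(X | K)` -/

namespace clocalHomology

variable {p q n : ℕ} {W K : Set X} (hK : IsClosed K) (hW : IsOpen W) (hKW : K ⊆ W)

/-- **`α ⌢ φ ∈ H_q(C(W); M)`** for `α ∈ Hₙ(X | K; M)`, `K ⊆ W` closed, `W` open, and a cochain
`φ ∈ Cᵖ(X, X ∖ K; R)` that is a cocycle on the `W`-small simplices: cap a `W`-small representative
of `α` (which exists by excision, Hatcher 2002, Prop. 2.21 / Thm. 2.20;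
`clocalHomology.exists_small_relCls_eq`) — Hatcher 2002, §3.3 p. 245, `φ ↦ μ_K ⌢ φ`, and proof of
Lemma 3.36 (p. 246), where it is computed inside `U ⊇ K`. [cite: HatcherAT2002, §3.3 p. 245] -/
def capc (h : p + q = n) {φ : SingularSimplex X p → R} (hφ : IsCocycleOn (coverOne W) φ)
    (hφK : φ ∈ relCochains R R Kᶜ p) (α : clocalHomology R M X K n) :
    (chainsInSub R M X W).toComplex.homology q :=
  capcSmall M W K h hφ hφK
    (exists_small_relCls_eq R M hK (fun _ => hW) (capcSmall.subset_iUnion_coverOne hKW) α).choose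
    (exists_small_relCls_eq R M hK (fun _ => hW) (capcSmall.subset_iUnion_coverOne hKW)
      α).choose_spec.choose
    (exists_small_relCls_eq R M hK (fun _ => hW) (capcSmall.subset_iUnion_coverOne hKW)
      α).choose_spec.choose_spec.choose

/-- `capc` may be computed on any `W`-small representative. [cite: HatcherAT2002, §3.3 p. 245] -/
theorem capc_eq_capcSmall (h : p + q = n) {φ : SingularSimplex X p → R}
    (hφ : IsCocycleOn (coverOne W) φ) (hφK : φ ∈ relCochains R R Kᶜ p)
    {α : clocalHomology R M X K n} (x : (csingularChainComplex R M X).X n)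
    (hxW : x ∈ smallChains R M X (coverOne W) n)
    (hx : (csingularChainComplex R M X).d n ((ComplexShape.down ℕ).next n) x ∈
      awaySub R M X K ((ComplexShape.down ℕ).next n))
    (e : (awaySub R M X K).relCls x hx = α) :
    capc hK hW hKW h hφ hφK α = capcSmall M W K h hφ hφK x hxW hx :=
  capcSmall.eq_of_relCls_eq hK hW hKW h hφ hφK _ _ _ _
    ((exists_small_relCls_eq R M hK (fun _ => hW) (capcSmall.subset_iUnion_coverOne hKW)
      α).choose_spec.choose_spec.choose_spec.trans e.symm)

/-- `α ⌢ (φ + ψ) = α ⌢ φ + α ⌢ ψ` (Hatcher 2002, §3.3 p. 239, bilinearity). [cite: HatcherAT2002, §3.3 p. 239] -/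
theorem capc_add (h : p + q = n) {φ ψ : SingularSimplex X p → R}
    (hφ : IsCocycleOn (coverOne W) φ) (hφK : φ ∈ relCochains R R Kᶜ p)
    (hψ : IsCocycleOn (coverOne W) ψ) (hψK : ψ ∈ relCochains R R Kᶜ p)
    (α : clocalHomology R M X K n) :
    capc hK hW hKW h (hφ.add hψ) ((relCochains R R Kᶜ p).add_mem hφK hψK) α =
      capc hK hW hKW h hφ hφK α + capc hK hW hKW h hψ hψK α := by
  obtain ⟨x, hxW, hx, rfl⟩ :=
    exists_small_relCls_eq R M hK (fun _ => hW) (capcSmall.subset_iUnion_coverOne hKW) α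
  rw [capc_eq_capcSmall hK hW hKW h _ _ x hxW hx rfl, capc_eq_capcSmall hK hW hKW h _ _ x hxW hx rfl,
    capc_eq_capcSmall hK hW hKW h _ _ x hxW hx rfl]
  exact capcSmall.add h hφ hφK hψ hψK hxW hx

/-- `α ⌢ (r • φ) = r • (α ⌢ φ)` (Hatcher 2002, §3.3 p. 239, bilinearity). [cite: HatcherAT2002, §3.3 p. 239] -/
theorem capc_smul (h : p + q = n) (r : R) {φ : SingularSimplex X p → R}
    (hφ : IsCocycleOn (coverOne W) φ) (hφK : φ ∈ relCochains R R Kᶜ p)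
    (α : clocalHomology R M X K n) :
    capc hK hW hKW h (hφ.smul r) ((relCochains R R Kᶜ p).smul_mem r hφK) α =
      r • capc hK hW hKW h hφ hφK α := by
  obtain ⟨x, hxW, hx, rfl⟩ :=
    exists_small_relCls_eq R M hK (fun _ => hW) (capcSmall.subset_iUnion_coverOne hKW) α
  rw [capc_eq_capcSmall hK hW hKW h _ _ x hxW hx rfl, capc_eq_capcSmall hK hW hKW h _ _ x hxW hx rfl]
  exact capcSmall.smul h r hφ hφK hxW hx

/-- `α ⌢ φ` only depends on `φ` (not on the proofs of the side conditions). [folklore] -/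
theorem capc_congr (h : p + q = n) {φ φ' : SingularSimplex X p → R} (e : φ = φ')
    (hφ : IsCocycleOn (coverOne W) φ) (hφK : φ ∈ relCochains R R Kᶜ p)
    (hφ' : IsCocycleOn (coverOne W) φ') (hφ'K : φ' ∈ relCochains R R Kᶜ p)
    (α : clocalHomology R M X K n) :
    capc hK hW hKW h hφ hφK α = capc hK hW hKW h hφ' hφ'K α := by
  subst e
  rfl

/-- **Relative coboundaries cap to zero**: `α ⌢ δθ = 0` for `θ ∈ Cᵖ'(X, X ∖ K; R)` (Hatcher 2002,
§3.3 p. 245: `μ_K ⌢ -` is defined on `H^k(M | K)`). [cite: HatcherAT2002, §3.3 p. 245] -/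
theorem capc_eq_zero_of_coboundary {p' : ℕ} (h : (p' + 1) + q = n)
    {φ : SingularSimplex X (p' + 1) → R} (hφ : IsCocycleOn (coverOne W) φ)
    (hφK : φ ∈ relCochains R R Kᶜ (p' + 1)) (θ : SingularSimplex X p' → R)
    (hθK : θ ∈ relCochains R R Kᶜ p')
    (e : ∀ σ : SingularSimplex X (p' + 1), (∃ i, σ.range ⊆ coverOne W i) →
      φ σ = (singularCochainComplex R R X).d p' (p' + 1) θ σ)
    (α : clocalHomology R M X K n) : capc hK hW hKW h hφ hφK α = 0 := by
  obtain ⟨x, hxW, hx, rfl⟩ :=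
    exists_small_relCls_eq R M hK (fun _ => hW) (capcSmall.subset_iUnion_coverOne hKW) α
  rw [capc_eq_capcSmall hK hW hKW h _ _ x hxW hx rfl]
  exact capcSmall.eq_zero_of_coboundary h hφ hφK θ hθK e hxW hx

/-- **Naturality in the compact set** (Hatcher 2002, §3.3 p. 245: "`i_*(μ_L) ⌢ x = μ_L ⌢ i^*(x)`"
for `K ⊆ L`, hence "`μ_K ⌢ x = μ_L ⌢ i^*(x)`"): for `K ⊆ L ⊆ W` closed, `β ∈ Hₙ(X | L)` and a
cochain `φ` vanishing off `K` (hence off `L`), `(β|_K) ⌢ φ = β ⌢ φ` in `H_q(C(W))`.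
[cite: HatcherAT2002, §3.3 p. 245] -/
theorem capc_res {L : Set X} (hL : IsClosed L) (hKL : K ⊆ L) (hLW : L ⊆ W) (h : p + q = n)
    {φ : SingularSimplex X p → R} (hφ : IsCocycleOn (coverOne W) φ)
    (hφK : φ ∈ relCochains R R Kᶜ p) (hφL : φ ∈ relCochains R R Lᶜ p)
    (β : clocalHomology R M X L n) :
    capc hK hW hKW h hφ hφK (res R M X hKL n β) = capc hL hW hLW h hφ hφL β := by
  obtain ⟨x, hxW, hx, rfl⟩ :=
    exists_small_relCls_eq R M hL (fun _ => hW) (capcSmall.subset_iUnion_coverOne hLW) β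
  have hxK : (csingularChainComplex R M X).d n ((ComplexShape.down ℕ).next n) x ∈
      awaySub R M X K ((ComplexShape.down ℕ).next n) := awaySub_mono R M hKL _ hx
  rw [capc_eq_capcSmall hL hW hLW h _ _ x hxW hx rfl, res_eq,
    Subcomplex.homologyMap_quotientMap_relCls, capc_eq_capcSmall hK hW hKW h _ _ x hxW hxK rfl]
  rfl

/-- A cochain vanishing on the simplices of `X ∖ K` vanishes on those of `X ∖ L` for `K ⊆ L`.
[folklore] -/
lemma relCochains_compl_anti {L : Set X} (hKL : K ⊆ L) {φ : SingularSimplex X p → R}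
    (hφK : φ ∈ relCochains R R Kᶜ p) : φ ∈ relCochains R R Lᶜ p :=
  fun σ hσ => hφK σ (hσ.trans (Set.compl_subset_compl.mpr hKL))

/-- **Naturality in the open set**: for `K ⊆ W ⊆ W'` the inclusion `C(W) ↪ C(W')` maps
`(α ⌢ φ)_W` to `(α ⌢ φ)_{W'}` (a `W`-small representative is `W'`-small; Hatcher 2002, proof of
Lemma 3.36, p. 246: the maps `H_{n-k}(U ∩ V) → H_{n-k}(U)` of the lower row). [cite: HatcherAT2002, Lemma 3.36] -/
theorem homologyMap_incl_capc {W' : Set X} (hW' : IsOpen W') (hWW' : W ⊆ W') (h : p + q = n)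
    {φ : SingularSimplex X p → R} (hφ : IsCocycleOn (coverOne W) φ)
    (hφ' : IsCocycleOn (coverOne W') φ) (hφK : φ ∈ relCochains R R Kᶜ p)
    (α : clocalHomology R M X K n) :
    HomologicalComplex.homologyMap (Subcomplex.incl (chainsInSub_mono R M hWW')) q
        (capc hK hW hKW h hφ hφK α) =
      capc hK hW' (hKW.trans hWW') h hφ' hφK α := by
  obtain ⟨x, hxW, hx, rfl⟩ :=
    exists_small_relCls_eq R M hK (fun _ => hW) (capcSmall.subset_iUnion_coverOne hKW) α
  have hxW' : x ∈ smallChains R M X (coverOne W') n :=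
    smallChains_mono_of_refines R M (U := coverOne W') (V := coverOne W) (fun _ => ⟨(), hWW'⟩) n hxW
  rw [capc_eq_capcSmall hK hW hKW h _ _ x hxW hx rfl,
    capc_eq_capcSmall hK hW' (hKW.trans hWW') h _ _ x hxW' hx rfl]
  unfold capcSmall
  rw [homologyMap_homologyCls]
  rfl

end clocalHomology

/-! ### `capcH`: the map `φ ↦ α ⌢ φ` on relative cohomology `Hᵖ(X, X ∖ K; R) → H_q(C(W); M)` -/

namespace relCochainComplex

variable {p : ℕ} {A : Set X}

/-- A relative cocycle (kernel form) is a cocycle of `X`, hence a cocycle on the small simplices of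
any cover. [folklore] -/
lemma isCocycleOn_of_mem_ker {ι : Type*} (U : ι → Set X)
    (ψ : LinearMap.ker ((relCochainComplex R R A).sc p).g.hom) : IsCocycleOn U (val ψ.1) := by
  refine IsCocycleOn.of_d_eq_zero U ?_
  have hψ := ψ.2
  rw [LinearMap.mem_ker] at hψ
  have e : val ((relCochainComplex R R A).d p ((ComplexShape.up ℕ).next p) ψ.1) = 0 := by
    change val (((relCochainComplex R R A).sc p).g ψ.1) = 0
    rw [hψ]; rfl
  rwa [val_d', CochainComplex.next] at e

/-- A relative cocycle is a cocycle on the small simplices of any cover. [folklore] -/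
lemma isCocycleOn_of_d_eq_zero {ι : Type*} (U : ι → Set X) (ψ : (relCochainComplex R R A).X p)
    (hψ : (relCochainComplex R R A).d p ((ComplexShape.up ℕ).next p) ψ = 0) :
    IsCocycleOn U (val ψ) :=
  isCocycleOn_of_mem_ker U ⟨ψ, LinearMap.mem_ker.mpr hψ⟩

end relCochainComplex

namespace clocalHomology

variable {p q n : ℕ} {W K : Set X} (hK : IsClosed K) (hW : IsOpen W) (hKW : K ⊆ W)

/-- `φ ↦ α ⌢ φ` on relative cocycles (kernel form), as an `R`-linear map. [cite: HatcherAT2002, §3.3 p. 245] -/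
def capcCocycles (h : p + q = n) (α : clocalHomology R M X K n) :
    LinearMap.ker ((relCochainComplex R R Kᶜ).sc p).g.hom →ₗ[R]
      (chainsInSub R M X W).toComplex.homology q where
  toFun ψ := capc hK hW hKW h (relCochainComplex.isCocycleOn_of_mem_ker (coverOne W) ψ)
    (relCochainComplex.val_mem ψ.1) α
  map_add' _ _ := capc_add hK hW hKW h _ _ _ _ α
  map_smul' r _ := capc_smul hK hW hKW h r _ _ α

/-- `φ ↦ α ⌢ φ` kills relative coboundaries. [cite: HatcherAT2002, §3.3 p. 245] -/
lemma capcCocycles_d (h : p + q = n) (α : clocalHomology R M X K n) (j : ℕ)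
    (w : (relCochainComplex R R Kᶜ).X j) :
    capcCocycles hK hW hKW h α ⟨(relCochainComplex R R Kᶜ).d j p w, d_mem_ker j w⟩ = 0 := by
  by_cases hj : (ComplexShape.up ℕ).Rel j p
  · obtain rfl : j + 1 = p := hj
    exact capc_eq_zero_of_coboundary hK hW hKW h
      (relCochainComplex.isCocycleOn_of_mem_ker (coverOne W) ⟨_, d_mem_ker j w⟩)
      (relCochainComplex.val_mem _) (relCochainComplex.val w)
      (relCochainComplex.val_mem w) (fun σ _ => by rw [relCochainComplex.val_d]) α
  · have e : (⟨(relCochainComplex R R Kᶜ).d j p w, d_mem_ker j w⟩ :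
        LinearMap.ker ((relCochainComplex R R Kᶜ).sc p).g.hom) = 0 := by
      apply Subtype.ext
      change (relCochainComplex R R Kᶜ).d j p w = 0
      rw [(relCochainComplex R R Kᶜ).shape j p hj]
      rfl
    rw [e, map_zero]

/-- **The map `φ ↦ α ⌢ φ : Hᵖ(X, X ∖ K; R) → H_q(C(W); M)`** for `α ∈ Hₙ(X | K; M)`, `K ⊆ W`
closed, `W` open, `p + q = n` (Hatcher 2002, §3.3 p. 245, the rows
`H_n(M | K; R) × H^k(M | K; R) → H_{n-k}(M; R)` of the diagram defining `D_M`, computed in `W` as in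
the proof of Lemma 3.36). [cite: HatcherAT2002, §3.3 p. 245] -/
def capcH (h : p + q = n) (α : clocalHomology R M X K n) :
    (relCochainComplex R R Kᶜ).homology p →ₗ[R] (chainsInSub R M X W).toComplex.homology q :=
  homologyDescKer (capcCocycles hK hW hKW h α) fun w => capcCocycles_d hK hW hKW h α _ w

/-- **`α ⌢ [ψ] = α ⌢ ψ`**: on the class of a relative cocycle `ψ`, `capcH` is `capc`.
[cite: HatcherAT2002, §3.3 p. 245] -/
theorem capcH_homologyCls (h : p + q = n) (α : clocalHomology R M X K n)
    (ψ : (relCochainComplex R R Kᶜ).X p)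
    (hψ : (relCochainComplex R R Kᶜ).d p ((ComplexShape.up ℕ).next p) ψ = 0)
    (hψ' : IsCocycleOn (coverOne W) (relCochainComplex.val ψ)) :
    capcH hK hW hKW h α (homologyCls ψ hψ) =
      capc hK hW hKW h hψ' (relCochainComplex.val_mem ψ) α := by
  rw [capcH, homologyDescKer_homologyCls]
  rfl

/-- Every class of `Hᵖ(X, X ∖ K; R)` is the class of a relative cocycle. [folklore] -/
lemma exists_homologyCls_eq (a : (relCochainComplex R R Kᶜ).homology p) :
    ∃ (ψ : (relCochainComplex R R Kᶜ).X p)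
      (hψ : (relCochainComplex R R Kᶜ).d p ((ComplexShape.up ℕ).next p) ψ = 0),
      homologyCls ψ hψ = a :=
  homologyCls_surjective a

/-- **Naturality of `capcH` in the compact set** (Hatcher 2002, §3.3 p. 245,
"`μ_K ⌢ x = μ_L ⌢ i^*(x)`"): for `K ⊆ L ⊆ W` closed and `β ∈ Hₙ(X | L)`,
`(β|_K) ⌢ a = β ⌢ (ext a)` where `ext : Hᵖ(X, X ∖ K) → Hᵖ(X, X ∖ L)` is induced by the identity of
`X` as a map of pairs `(X, X ∖ L) → (X, X ∖ K)`. [cite: HatcherAT2002, §3.3 p. 245] -/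
theorem capcH_res {L : Set X} (hL : IsClosed L) (hKL : K ⊆ L) (hLW : L ⊆ W) (h : p + q = n)
    (β : clocalHomology R M X L n) (a : (relCochainComplex R R Kᶜ).homology p) :
    capcH hK hW hKW h (res R M X hKL n β) a =
      capcH hL hW hLW h β (HomologicalComplex.homologyMap (relCochainComplex.map R R
        (ContinuousMap.id X) (fun _ hx => Set.compl_subset_compl.mpr hKL hx)) p a) := by
  obtain ⟨ψ, hψ, rfl⟩ := exists_homologyCls_eq a
  rw [capcH_homologyCls hK hW hKW h _ ψ hψ (relCochainComplex.isCocycleOn_of_d_eq_zero _ ψ hψ),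
    homologyMap_homologyCls,
    capcH_homologyCls hL hW hLW h _ _ _ (relCochainComplex.isCocycleOn_of_d_eq_zero _ _
      (d_hom_f_eq_zero _ ψ hψ)),
    capc_res hK hW hKW hL hKL hLW h _ (relCochainComplex.val_mem ψ)
      (relCochains_compl_anti hKL (relCochainComplex.val_mem ψ))]
  -- the two sides now agree up to `σ.map (𝟙 X) = σ`, which holds by `rfl`

/-- **Naturality of `capcH` in the open set**: for `K ⊆ W ⊆ W'`,
`incl_* (α ⌢ a)_W = (α ⌢ a)_{W'}`. [cite: HatcherAT2002, Lemma 3.36] -/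
theorem homologyMap_incl_capcH {W' : Set X} (hW' : IsOpen W') (hWW' : W ⊆ W') (h : p + q = n)
    (α : clocalHomology R M X K n) (a : (relCochainComplex R R Kᶜ).homology p) :
    HomologicalComplex.homologyMap (Subcomplex.incl (chainsInSub_mono R M hWW')) q
        (capcH hK hW hKW h α a) =
      capcH hK hW' (hKW.trans hWW') h α a := by
  obtain ⟨ψ, hψ, rfl⟩ := exists_homologyCls_eq a
  rw [capcH_homologyCls hK hW hKW h _ ψ hψ (relCochainComplex.isCocycleOn_of_d_eq_zero _ ψ hψ),
    capcH_homologyCls hK hW' (hKW.trans hWW') h _ ψ hψ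
      (relCochainComplex.isCocycleOn_of_d_eq_zero _ ψ hψ)]
  exact homologyMap_incl_capc hK hW hKW hW' hWW' h _ _ _ α

end clocalHomology

end Literature.AlgebraicTopology.SingularHomology
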